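import Literature.NumberTheory.Automorphic.UnitaryGroupTransferAway
import Literature.NumberTheory.Rogawski1990.TestFunctionsNonempty
import HarnessLib

/-!
# Every smooth pure tensor on `U(H)(𝔸)` has a smooth TRANSFER PARTNER on `U(H′)(𝔸)` away from the bad places
# (satisfiability of `GlobalTransferAway` for the anchored ENGINE T1 kit)
(Rogawski, *Automorphic representations of unitary groups in three variables* (1990), §14.2 p. 233)

Topic `NumberTheory/Automorphic`; namespace `Literature.NumberTheory.Automorphic.UnitaryGroup`.  THEOREMS ONLY (no definition, no named
fact, no `sorry`, no instance).  Sequel of ★ `UnitaryGroupTransferAway` (B11: `GlobalTransferAway ψ S₀ f′ f`, `PureTensor.unit`,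
`exists_psi_forall_levelMatching`) over ★ `Rogawski1990/TestFunctions` ed. 2 (`PureTensor.IsUnramified ∕ IsFinSmooth ∕ IsArchTest ∕ IsTest`)
and ★ `Rogawski1990/TestFunctionsNonempty` (B14: the smooth archimedean bump `exists_archBump`).

For local identifications `ψ_v : U(H)(L⁺_v) ≃ₜ* U(H′)(L⁺_v)` matching the integral levels off a finite set `S₀`
(`ψ_v g ∈ U(H′)(𝒪_v) ↔ g ∈ U(H)(𝒪_v)`), and a pure tensor `T = f_∞ ⊗ ⊗_v f_v` on `U(H)` that is unramified and finitely smooth: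

* `PureTensor.exists_isTest_forall_loc_eq_comp_symm` — there is a pure tensor `T′` on `U(H′)` with `T′.IsTest`, bad set `S₀ ∪ S`, and
  `T′.loc v = T.loc v ∘ ψ_v⁻¹` at EVERY finite place (off `S₀ ∪ S` this IS the indicator of `U(H′)(𝒪_v)` by level matching; at
  infinity any smooth bump, ★ `exists_archBump`) — the «`f_v := f′_v ∘ ψ_v⁻¹` for `v ∉ S₀ ∪ S`» half of [Rogawski1990, §14.2 p. 233],
  with the bad places and `∞` filled arbitrarily (honest over-approximation: the transfer-factor layer is elsewhere);
* `exists_isTest_globalTransferAway_of_isTest` — hence for every `T` with `T.IsTest` there is `T′` with `T′.IsTest` and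
  `GlobalTransferAway ψ S₀ (T.toCc …) (T′.toCc …)`;
* `exists_smooth_globalTransferAway_of_smooth` — in the currency of the line's kit (`Smooth f′ ↔ ∃ T, T.IsTest ∧ ⇑f′ = T.eval`): every
  smooth `f′ ∈ C_c(U(H)(𝔸))` has a smooth `f ∈ C_c(U(H′)(𝔸))` with `GlobalTransferAway ψ S₀ f′ f` — the satisfiability of the pins
  (iv) + (vi) + T1g of the line `F0_T1InnerFormTraceIdentity` for `Transfer := GlobalTransferAway ψ S₀`.

Written for the cell `hodgecm-mathlib` (ENGINE T1, brick B11c).  HC_CM is proved only modulo the printed citations until rung 0 closes; this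
file is unconditional.

## References
* [Rogawski1990] J. Rogawski, Ann. of Math. Stud. 123 (1990), §14.2 p. 233.
* [BorelJacquet1979] A. Borel, H. Jacquet, PSPM 33.1 (1979), §4.1.
-/

set_option autoImplicit false

noncomputable section

open NumberField IsDedekindDomain Filter Set
open scoped Classical

namespace Literature.NumberTheory.Automorphic.UnitaryGroup

variable (L : Type) [Field L] [NumberField L] [IsCMField L] (N : ℕ) {H H' : Matrix (Fin N) (Fin N) L}

/-- **The transfer partner.**  `ψ_v` matching the integral levels off `S₀`, `T` an unramified finitely-smooth pure tensor on `U(H)`: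
there is `T′` on `U(H′)` with `T′.IsTest`, `T′.S = S₀ ∪ T.S`, and `T′.loc v = T.loc v ∘ ψ_v⁻¹` at every finite `v` (levels
`U(H′)(𝒪_v)`; archimedean factor the restriction of a smooth bump, ★ `exists_archBump`). [cite: Rogawski1990, §14.2 p. 233] -/
theorem PureTensor.exists_isTest_forall_loc_eq_comp_symm
    (ψ : ∀ v : HeightOneSpectrum (𝓞 ↥(maximalRealSubfield L)), (cmDatum L N H).Local v ≃ₜ* (cmDatum L N H').Local v)
    (S₀ : Finset (HeightOneSpectrum (𝓞 ↥(maximalRealSubfield L))))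
    (hψ : ∀ v ∉ S₀, ∀ g, ψ v g ∈ cmLocalIntegralLevel L N H' v ↔ g ∈ cmLocalIntegralLevel L N H v)
    (T : PureTensor L N H) (hT : T.IsUnramified) (hS : T.IsFinSmooth) :
    ∃ T' : PureTensor L N H', T'.IsTest ∧ T'.S = S₀ ∪ T.S ∧ ∀ v, T'.loc v = T.loc v ∘ (ψ v).symm := by
  obtain ⟨φ, hφc, hφs, hφsm, -⟩ := exists_archBump L N
  -- level matching turns `1_{U(H)(𝒪_v)} ∘ ψ_v⁻¹` into `1_{U(H′)(𝒪_v)}` off `S₀`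
  have hind : ∀ v ∉ S₀,
      ((cmLocalIntegralLevel L N H v : Set ((cmDatum L N H).Local v)).indicator fun _ => (1 : ℂ)) ∘ (ψ v).symm =
        (cmLocalIntegralLevel L N H' v : Set ((cmDatum L N H').Local v)).indicator fun _ => (1 : ℂ) := by
    intro v hv₀
    funext k'
    change ((cmLocalIntegralLevel L N H v : Set ((cmDatum L N H).Local v))).indicator (fun _ => (1 : ℂ)) ((ψ v).symm k') =
      ((cmLocalIntegralLevel L N H' v : Set ((cmDatum L N H').Local v))).indicator (fun _ => (1 : ℂ)) k'
    by_cases hk : k' ∈ cmLocalIntegralLevel L N H' v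
    · have hk' : (ψ v).symm k' ∈ cmLocalIntegralLevel L N H v :=
        (hψ v hv₀ _).1 (by rw [ContinuousMulEquiv.apply_symm_apply]; exact hk)
      rw [Set.indicator_of_mem (show k' ∈ (cmLocalIntegralLevel L N H' v : Set _) from hk),
        Set.indicator_of_mem (show (ψ v).symm k' ∈ (cmLocalIntegralLevel L N H v : Set _) from hk')]
    · have hk' : (ψ v).symm k' ∉ cmLocalIntegralLevel L N H v := fun h =>
        hk (by have h' := (hψ v hv₀ _).2 h; rwa [ContinuousMulEquiv.apply_symm_apply] at h')
      rw [Set.indicator_of_notMem (show k' ∉ (cmLocalIntegralLevel L N H' v : Set _) from hk),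
        Set.indicator_of_notMem (show (ψ v).symm k' ∉ (cmLocalIntegralLevel L N H v : Set _) from hk')]
  let T' : PureTensor L N H' :=
    { S := S₀ ∪ T.S
      K := fun v => cmLocalIntegralLevel L N H' v
      loc := fun v => T.loc v ∘ (ψ v).symm
      arch := fun k => φ (k : GL (Fin N) (NumberField.mixedEmbedding.mixedSpace L))
      loc_eq_indicator := fun v hv => by
        rw [Finset.notMem_union] at hv
        rw [hT.loc_eq hv.2, hind v hv.1] }
  refine ⟨T', ⟨fun _ _ => rfl, fun v _ => ⟨?_, ?_⟩, ⟨φ, hφc, hφs, hφsm, fun _ => rfl⟩⟩, rfl, fun _ => rfl⟩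
  · -- locally constant: `f_v ∘ ψ_v⁻¹` with `f_v` locally constant
    change IsLocallyConstant (T.loc v ∘ (ψ v).symm)
    exact (PureTensor.isLocallyConstant_loc hT hS v).comp_continuous (ψ v).symm.continuous
  · -- compact support: `f_v ∘ ψ_v⁻¹` with `f_v` compactly supported, `ψ_v` a homeomorphism
    change HasCompactSupport (T.loc v ∘ (ψ v).symm)
    exact (PureTensor.hasCompactSupport_loc hT hS v).comp_homeomorph (ψ v).symm.toHomeomorph

/-- **Every `IsTest` pure tensor has an `IsTest` transfer partner**: `GlobalTransferAway ψ S₀ (T.toCc) (T′.toCc)` with `T′.IsTest` (the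
`C_c` packaging ★ `PureTensor.toCc`, side conditions from `IsTest`). [cite: Rogawski1990, §14.2 p. 233] -/
theorem exists_isTest_globalTransferAway_of_isTest
    (ψ : ∀ v : HeightOneSpectrum (𝓞 ↥(maximalRealSubfield L)), (cmDatum L N H).Local v ≃ₜ* (cmDatum L N H').Local v)
    (S₀ : Finset (HeightOneSpectrum (𝓞 ↥(maximalRealSubfield L))))
    (hψ : ∀ v ∉ S₀, ∀ g, ψ v g ∈ cmLocalIntegralLevel L N H' v ↔ g ∈ cmLocalIntegralLevel L N H v)
    (T : PureTensor L N H) (hT : T.IsTest) :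
    ∃ (T' : PureTensor L N H') (hT' : T'.IsTest),
      GlobalTransferAway L N ψ S₀
        (T.toCc hT.isUnramified hT.isArchTest.continuous_arch hT.isArchTest.hasCompactSupport_arch
          (fun v _ => PureTensor.continuous_loc hT.isUnramified hT.isFinSmooth v)
          (fun v _ => PureTensor.hasCompactSupport_loc hT.isUnramified hT.isFinSmooth v))
        (T'.toCc hT'.isUnramified hT'.isArchTest.continuous_arch hT'.isArchTest.hasCompactSupport_arch
          (fun v _ => PureTensor.continuous_loc hT'.isUnramified hT'.isFinSmooth v)
          (fun v _ => PureTensor.hasCompactSupport_loc hT'.isUnramified hT'.isFinSmooth v)) := by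
  obtain ⟨T', hT', -, hloc⟩ :=
    PureTensor.exists_isTest_forall_loc_eq_comp_symm L N ψ S₀ hψ T hT.isUnramified hT.isFinSmooth
  exact ⟨T', hT', T, T', rfl, rfl, fun v _ => hloc v⟩

/-- **Satisfiability of the pins (iv) + (vi) of the line `F0_T1InnerFormTraceIdentity` for `Transfer := GlobalTransferAway ψ S₀`**: every
SMOOTH `f′ ∈ C_c(U(H)(𝔸))` (`∃ T, T.IsTest ∧ ⇑f′ = T.eval`) has a SMOOTH `f ∈ C_c(U(H′)(𝔸))` with `GlobalTransferAway ψ S₀ f′ f`.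
[cite: Rogawski1990, §14.2 p. 233] -/
theorem exists_smooth_globalTransferAway_of_smooth
    (ψ : ∀ v : HeightOneSpectrum (𝓞 ↥(maximalRealSubfield L)), (cmDatum L N H).Local v ≃ₜ* (cmDatum L N H').Local v)
    (S₀ : Finset (HeightOneSpectrum (𝓞 ↥(maximalRealSubfield L))))
    (hψ : ∀ v ∉ S₀, ∀ g, ψ v g ∈ cmLocalIntegralLevel L N H' v ↔ g ∈ cmLocalIntegralLevel L N H v)
    (f' : CompactlySupportedContinuousMap (cmDatum L N H).Adelic ℂ) (hf' : ∃ T : PureTensor L N H, T.IsTest ∧ ⇑f' = T.eval) :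
    ∃ f : CompactlySupportedContinuousMap (cmDatum L N H').Adelic ℂ,
      (∃ T' : PureTensor L N H', T'.IsTest ∧ ⇑f = T'.eval) ∧ GlobalTransferAway L N ψ S₀ f' f := by
  obtain ⟨T, hT, hf'T⟩ := hf'
  obtain ⟨T', hT', -, hloc⟩ :=
    PureTensor.exists_isTest_forall_loc_eq_comp_symm L N ψ S₀ hψ T hT.isUnramified hT.isFinSmooth
  exact ⟨T'.toCc hT'.isUnramified hT'.isArchTest.continuous_arch hT'.isArchTest.hasCompactSupport_arch
      (fun v _ => PureTensor.continuous_loc hT'.isUnramified hT'.isFinSmooth v)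
      (fun v _ => PureTensor.hasCompactSupport_loc hT'.isUnramified hT'.isFinSmooth v),
    ⟨T', hT', rfl⟩, T, T', hf'T, rfl, fun v _ => hloc v⟩

/-- **The anchored kit's `Transfer` is satisfiable for `N = 3`** (T1g + (iv) + (vi) together): for an anisotropic hermitian `H ∈ M₃(L)`,
with the level-matching `ψ, S₀` of ★ `exists_psi_forall_levelMatching`, every smooth `f′` on `U(H)(𝔸)` has a smooth partner `f` on
`U(Φ₃)(𝔸)` with `GlobalTransferAway ψ S₀ f′ f`, and smooth `f′ ≠ 0` exist (★ `exists_compactlySupported_isTest_ne_zero`).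
[cite: Rogawski1990, §14.2 p. 233] -/
theorem exists_psi_globalTransferAway_satisfiable (H : Matrix (Fin 3) (Fin 3) L)
    (hanis : ∀ x : Fin 3 → L, Literature.AlgebraicGeometry.ShimuraVarieties.hermForm (cmConjRingHom L) H x x = 0 → x = 0)
    (hherm : (H.map (cmConjRingHom L)).transpose = H) :
    ∃ (ψ : ∀ v : HeightOneSpectrum (𝓞 ↥(maximalRealSubfield L)), (cmDatum L 3 H).Local v ≃ₜ*
        (cmDatum L 3 (Matrix.of fun i j : Fin 3 => if i.val + j.val + 1 = 3 then (1 : L) else 0)).Local v)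
      (S₀ : Finset (HeightOneSpectrum (𝓞 ↥(maximalRealSubfield L)))),
      (∀ v ∉ S₀, ∀ g, ψ v g ∈ cmLocalIntegralLevel L 3 (Matrix.of fun i j : Fin 3 => if i.val + j.val + 1 = 3 then (1 : L) else 0) v ↔
        g ∈ cmLocalIntegralLevel L 3 H v) ∧
      (∃ f' : CompactlySupportedContinuousMap (cmDatum L 3 H).Adelic ℂ,
        (∃ T : PureTensor L 3 H, T.IsTest ∧ ⇑f' = T.eval) ∧ f' ≠ 0) ∧
      ∀ f' : CompactlySupportedContinuousMap (cmDatum L 3 H).Adelic ℂ, (∃ T : PureTensor L 3 H, T.IsTest ∧ ⇑f' = T.eval) →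
        ∃ f : CompactlySupportedContinuousMap
            (cmDatum L 3 (Matrix.of fun i j : Fin 3 => if i.val + j.val + 1 = 3 then (1 : L) else 0)).Adelic ℂ,
          (∃ T' : PureTensor L 3 (Matrix.of fun i j : Fin 3 => if i.val + j.val + 1 = 3 then (1 : L) else 0),
            T'.IsTest ∧ ⇑f = T'.eval) ∧ GlobalTransferAway L 3 ψ S₀ f' f := by
  obtain ⟨ψ, S₀, hψ⟩ := exists_psi_forall_levelMatching L H hanis hherm
  obtain ⟨f', hf', -, hf'0⟩ := exists_compactlySupported_isTest_ne_zero L 3 H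
  exact ⟨ψ, S₀, hψ, ⟨f', hf', hf'0⟩, fun g hg => exists_smooth_globalTransferAway_of_smooth L 3 ψ S₀ hψ g hg⟩

end Literature.NumberTheory.Automorphic.UnitaryGroup

end
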